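import Literature.NumberTheory.IwasawaTheory.CyclotomicTwoTotallyRamifiedIndexOne
import Literature.NumberTheory.NumberFields.CyclotomicTwoTowerLayerPolynomials
import HarnessLib

/-!
# NARROW FUKUDA at every rung: the layer models `K_n ≅ K(θ_n)` (`Ψ_n(θ_n) = 0`) of the cyclotomic `ℤ₂`-tower of an
# odd-degree number field, `(θ_n)^{2ⁿ} = (2)`, the generic Fukuda index bound, and the rung-`m` narrow rank certificate

Topic `NumberTheory/IwasawaTheory` (namespace = path). THEOREM-ONLY file (no definition, no named fact, no `sorry`), written by the prover seat
`cruxlead-stmt-BirchSwinnertonDyer-19573-w2` GEN 11 (cell `bsd-2adic`; `--supports` stmt-BirchSwinnertonDyer-19573; closes nothing).  Sequel of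
`NarrowFukudaCertificateLayerModels` (GEN 9: rung `0`, `K_1 ≅ K(√2)`), `NarrowFukudaCertificateLayerTwoModel` (GEN 10: rung `1`, `K_2 ≅ K(√(2+√2))`) and
`CyclotomicTwoTotallyRamifiedIndexOne` (GEN 10: index `≤ 1`), made uniform in the layer by the layer polynomials `Ψ_n`
(`NumberFields/CyclotomicTwoTowerLayerPolynomials`: `Ψ_0 = X`, `Ψ_{n+1} = Ψ_n² − 2`, written `((X ^ 2 - C 2).comp)^[n] X`; «`θ` is a root
of `Ψ_n`» is written `(fun x => x ^ 2 - 2)^[n] θ = 0`).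

* §1 `ℚ_n` and `K_n` contain a root of `Ψ_n`: `CyclotomicZp.exists_mem_layer_iterate_zpExtension`, `ZpExtension.IsCyclotomic.exists_iterate_root_layer`
  (every cyclotomic `κ` of `ℚ`, every `n`: `θ_n = ζ_{2^{n+2}} + ζ_{2^{n+2}}⁻¹ ∈ ℚ_n`, GEN 10's `add_inv_mem_layer`), **`exists_iterate_root_layer_of_not_dvd_finrank`**
  (`2 ∤ [K:ℚ]`); **`nonempty_algEquiv_layer_of_iterate_root`** (`[K:ℚ]` odd: `K_n ≃ₐ[K] L` for EVERY `L/K` of degree `2ⁿ` with a root of `Ψ_n`);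
  `index_range_pow_narrowClassGroup_layer_eq_of_iterate_root` (transport of `[Cl⁺ : (Cl⁺)^q]`); `index_range_pow_narrowClassGroup_layer_eq_of_isCyclotomic`
  (two cyclotomic `κ` have the same layers).
* §2 `(θ)^{2ⁿ} = (2)`: `isUnit_of_pow_eq_two_mul` (a ring lemma: `θ^N = 2u`, `u ≡ ε (mod θ)`, `ε` a unit ⟹ `u` a unit), **`span_two_eq_span_singleton_pow`**
  (`2𝓞_L = (θ)^{2^{n+1}}` for a root `θ ∈ L` of `Ψ_{n+1}`: `Ψ_{n+1} = X^{2^{n+1}} + 2q`, `q(0) = ±1`), **`pow_dvd_ramificationIdx_int_of_iterate_root`**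
  (`2ⁿ ∣ e(Q|2)` for every prime `Q ∣ 2` of a number field containing a root of `Ψ_n` — `ℚ_n/ℚ` is totally ramified at `2`).
* §3 Fukuda's index: `not_isUnramifiedIn_layer_of_not_pow_dvd_ramificationIdx` (`2ⁿ ∤ e(w|2)` ⟹ `w` ramifies in `K_n`),
  **`totallyRamifiedFrom_of_forall_not_pow_succ_dvd_ramificationIdx`** (`2^{m+1} ∤ e(w|2)` for all `w ∣ 2` ⟹ index `≤ m`), **`forall_totallyRamifiedFrom_of_finrank_lt`**
  (`[K:ℚ]` odd and `< 2^{m+1}` ⟹ index `≤ m` for every cyclotomic `ℤ₂`-extension: degree `3` ⟹ `≤ 1`, degrees `5, 7` ⟹ `≤ 2`, …).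
* §4 Certificates: **`NarrowFukuda.narrowMu_of_index_le_of_succ_eq`** (abstract layers: index `≤ m` and `rank₂ Cl⁺(K_{m+1}) = rank₂ Cl⁺(K_m)` for every cyclotomic `κ`
  ⟹ (a) `μ₂ = 0` for every cyclotomic `κ` ∧ (b) ONE bound `D`, uniform in `κ`, with `ord₂ h⁺(K_j) ≤ ord₂ h(K_j) + D` for all layers);
  ★ **`NarrowFukuda.narrowMu_of_layer_models`** (rung `m` with concrete models: `[K:ℚ]` odd, index `≤ m`, `L ⊇ K` of degree `2^m` with a root of `Ψ_m`, `L' ⊇ K` of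
  degree `2^{m+1}` with a root of `Ψ_{m+1}`, and `[Cl⁺(L') : Cl⁺(L')²] = [Cl⁺(L) : Cl⁺(L)²]` ⟹ (a) ∧ (b)); `…_of_finrank_lt` (index hypothesis discharged by
  `[K:ℚ] < 2^{m+1}`); **`…_of_finrank_eq_three`** (cubic `K`, ANY rung `m ≥ 1`, no other hypothesis); `…_layerThree_of_finrank_eq_three` (the rung `m = 2` spelled
  out: degrees `12` and `24`, `θ⁴ − 4θ² + 2 = 0` and `θ⁸ − 8θ⁶ + 20θ⁴ − 16θ² + 2 = 0`).

Not done here: no certificate is asserted for any field (each rung is one finite narrow class-group equality, decided by numerics elsewhere).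
References: [Fukuda1994] Thm. 1 (2), p. 264; [Washington1997] §13.1 (`ℚ_n = ℚ(ζ_{2^{n+2}})⁺`, `K_n = Kℚ_n`), Prop. 13.2, Lemma 13.3 (proof);
[NeukirchANT1999] Ch. I §8, Ch. II §6; [Kida1982JFields] (μ-part; shape).  BSD is not proved by any of this.
-/

set_option autoImplicit false

noncomputable section

open scoped NumberField Polynomial IntermediateField
open NumberField Field Polynomial UniqueFactorizationMonoid

namespace Literature.NumberTheory.EllipticCurves

open Literature.NumberTheory.NumberFields Literature.NumberTheory.GaloisRepresentations

/-! ## §1 The layers contain a root of `Ψ_n`; models and transport -/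

/-- **`∃ t ∈ ℚ_n` with `Ψ_n(t) = 0`** for the normalised cyclotomic `ℤ₂`-extension of `ℚ`: `t = ζ_{2^{n+2}} + ζ_{2^{n+2}}⁻¹` (GEN 10's
`exists_isPrimitiveRoot_add_inv_mem_layer_zpExtension` + `NestedSqrtTwo.iterate_add_inv_eq_zero`). [cite: Washington1997, §13.1 (`ℚ_n = ℚ(ζ_{2^{n+2}})⁺`)] -/
theorem CyclotomicZp.exists_mem_layer_iterate_zpExtension (n : ℕ) :
    ∃ t : AlgebraicClosure ℚ, t ∈ (CyclotomicZp.zpExtension 2).layer n ∧ (fun x : AlgebraicClosure ℚ => x ^ 2 - 2)^[n] t = 0 := by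
  obtain ⟨ζ, hζ, hmem⟩ := CyclotomicZp.exists_isPrimitiveRoot_add_inv_mem_layer_zpExtension n
  exact ⟨ζ + ζ⁻¹, hmem, NestedSqrtTwo.iterate_add_inv_eq_zero hζ⟩

/-- **`∃ θ : ℚ_n` with `Ψ_n(θ) = 0` for EVERY cyclotomic `ℤ₂`-extension `κ` of `ℚ` and every `n`** (`θ = ζ_{2^{n+2}} + ζ_{2^{n+2}}⁻¹ ∈ κ.layer n`,
GEN 10's `IsCyclotomic.add_inv_mem_layer`). The cases `n = 1, 2` are `exists_sq_eq_two_layer_one`, `exists_quartic_root_layer_two`.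
[cite: Washington1997, §13.1 (`ℚ_n = ℚ(ζ_{2^{n+2}})⁺`)] -/
theorem ZpExtension.IsCyclotomic.exists_iterate_root_layer {κ : ZpExtension ℚ 2} (hκ : κ.IsCyclotomic) (n : ℕ) :
    ∃ θ : κ.layer n, (fun x : κ.layer n => x ^ 2 - 2)^[n] θ = 0 := by
  haveI : NeZero (2 ^ (n + 2) : ℕ) := ⟨pow_ne_zero _ two_ne_zero⟩
  obtain ⟨ζ, hζ⟩ := HasEnoughRootsOfUnity.exists_primitiveRoot (AlgebraicClosure ℚ) (2 ^ (n + 2))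
  have hmem := ZpExtension.IsCyclotomic.add_inv_mem_layer hκ n hζ
  refine ⟨⟨ζ + ζ⁻¹, hmem⟩, ?_⟩
  have h := NestedSqrtTwo.map_iterate (algebraMap (κ.layer n) (AlgebraicClosure ℚ)) ⟨ζ + ζ⁻¹, hmem⟩ n
  rw [show algebraMap (κ.layer n) (AlgebraicClosure ℚ) ⟨ζ + ζ⁻¹, hmem⟩ = ζ + ζ⁻¹ from rfl,
    NestedSqrtTwo.iterate_add_inv_eq_zero hζ] at h
  exact (map_eq_zero_iff _ (algebraMap (κ.layer n) (AlgebraicClosure ℚ)).injective).mp h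

end Literature.NumberTheory.EllipticCurves

namespace Literature.NumberTheory.IwasawaTheory

open Literature.NumberTheory.EllipticCurves Literature.NumberTheory.NumberFields Literature.NumberTheory.GaloisRepresentations
  IsDedekindDomain

variable {K : Type} [Field K] [NumberField K]

/-- **`K_n` contains a root of `Ψ_n`** (`2 ∤ [K:ℚ]`, `κ` a cyclotomic `ℤ₂`-extension of `K`): `K_n = Kℚ_n ∋ ζ_{2^{n+2}} + ζ_{2^{n+2}}⁻¹`.  Assembled as
the cases `n = 1, 2` (`exists_sq_eq_two_layer_one_of_not_dvd_finrank`, `exists_quartic_root_layer_two_of_not_dvd_finrank`): `κ` is a unit twist of the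
restriction `κ_cyc ∘ res`, whose layers contain the images of the layers of `ℚ`. [cite: Washington1997, §13.1 (`K_n = Kℚ_n`)] -/
theorem exists_iterate_root_layer_of_not_dvd_finrank (hK : ¬ 2 ∣ Module.finrank ℚ K)
    (κ : ZpExtension K 2) (hκ : κ.IsCyclotomic) (n : ℕ) : ∃ θ : κ.layer n, (fun x : κ.layer n => x ^ 2 - 2)^[n] θ = 0 := by
  have hsurj := ZpExtension.surjective_comp_absGaloisRestrict_of_not_dvd_finrank
    (CyclotomicZp.zpExtension 2) K hK
  have hcyc : ((CyclotomicZp.zpExtension 2).restrict K hsurj).IsCyclotomic :=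
    ZpExtension.isCyclotomic_restrict _ (CyclotomicZp.isCyclotomic_zpExtension 2) K hsurj
  obtain ⟨u, rfl⟩ := ZpExtension.IsCyclotomic.exists_eq_unitTwist_holds hcyc hκ
  obtain ⟨t, ht, ht0⟩ := CyclotomicZp.exists_mem_layer_iterate_zpExtension n
  have hmem : absClosureEmbedding ℚ K t ∈
      (((CyclotomicZp.zpExtension 2).restrict K hsurj).unitTwist u).layer n := by
    rw [ZpExtension.layer_unitTwist]
    exact ZpExtension.absClosureEmbedding_mem_layer_restrict _ K hsurj n ht
  refine ⟨⟨absClosureEmbedding ℚ K t, hmem⟩, ?_⟩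
  set M := (((CyclotomicZp.zpExtension 2).restrict K hsurj).unitTwist u).layer n
  have h2 := NestedSqrtTwo.map_iterate ((absClosureEmbedding ℚ K : AlgebraicClosure ℚ →ₐ[ℚ] AlgebraicClosure K) :
      AlgebraicClosure ℚ →+* AlgebraicClosure K) t n
  rw [RingHom.coe_coe, ht0, map_zero] at h2
  have h := NestedSqrtTwo.map_iterate (algebraMap M (AlgebraicClosure K)) ⟨absClosureEmbedding ℚ K t, hmem⟩ n
  rw [show algebraMap M (AlgebraicClosure K) ⟨absClosureEmbedding ℚ K t, hmem⟩ = absClosureEmbedding ℚ K t from rfl, ← h2] at h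
  exact (map_eq_zero_iff _ (algebraMap M (AlgebraicClosure K)).injective).mp h

/-- **`K_n ≃ₐ[K] L` for every extension `L/K` of degree `2ⁿ` containing a root of `Ψ_n`**, for every cyclotomic `ℤ₂`-extension `κ` of an odd-degree
number field `K` (`K_n` contains a root of `Ψ_n`, `[K_n : K] = 2ⁿ`, and `Ψ_n` is irreducible over `K`: `NestedSqrtTwo.nonempty_algEquiv_of_root_of_odd_finrank`).
[cite: Washington1997, §13.1 (`K_n = Kℚ_n`, `[K_n : K] = 2ⁿ`)] -/
theorem nonempty_algEquiv_layer_of_iterate_root (hodd : Odd (Module.finrank ℚ K)) (κ : ZpExtension K 2) (hκ : κ.IsCyclotomic)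
    (L : Type*) [Field L] [Algebra K L] [FiniteDimensional K L] {n : ℕ} (hL : Module.finrank K L = 2 ^ n) (θ : L)
    (hθ : (fun x : L => x ^ 2 - 2)^[n] θ = 0) : Nonempty (κ.layer n ≃ₐ[K] L) := by
  haveI : Fact (Nat.Prime 2) := ⟨Nat.prime_two⟩
  have hK : ¬ 2 ∣ Module.finrank ℚ K := fun h => (Nat.not_even_iff_odd.mpr hodd) (even_iff_two_dvd.mpr h)
  obtain ⟨θn, hθn⟩ := exists_iterate_root_layer_of_not_dvd_finrank hK κ hκ n
  haveI : FiniteDimensional K (κ.layer n) := κ.finiteDimensional_layer_holds n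
  have hn : Module.finrank K (κ.layer n) = 2 ^ n := κ.finrank_layer_holds n
  exact NestedSqrtTwo.nonempty_algEquiv_of_root_of_odd_finrank hodd hn θn hθn hL θ hθ

/-- **`[Cl⁺(K_n) : Cl⁺(K_n)^q] = [Cl⁺(L) : Cl⁺(L)^q]`** for every degree-`2ⁿ` extension `L/K` with a root of `Ψ_n` (`[K:ℚ]` odd, `κ` cyclotomic), any `NumberField`
instance on the layer. [cite: Fukuda1994, Thm. 1 (2), p. 264 (`rank(A_n)`)] [cite: Washington1997, §13.1] -/
theorem index_range_pow_narrowClassGroup_layer_eq_of_iterate_root (hodd : Odd (Module.finrank ℚ K)) (κ : ZpExtension K 2) (hκ : κ.IsCyclotomic)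
    (L : Type*) [Field L] [NumberField L] [Algebra K L] {n : ℕ} (hL : Module.finrank K L = 2 ^ n) (θ : L)
    (hθ : (fun x : L => x ^ 2 - 2)^[n] θ = 0) (q : ℕ) [NumberField (κ.layer n)] :
    (powMonoidHom (α := NarrowClassGroup (κ.layer n)) q).range.index = (powMonoidHom (α := NarrowClassGroup L) q).range.index := by
  haveI : FiniteDimensional K L := Module.Finite.of_restrictScalars_finite ℚ K L
  obtain ⟨e⟩ := nonempty_algEquiv_layer_of_iterate_root hodd κ hκ L hL θ hθ
  exact index_range_pow_narrowClassGroup_eq_of_ringEquiv e.toRingEquiv q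

omit [NumberField K] in
/-- **Two cyclotomic `ℤ₂`-extensions of the same field have the same narrow `q`-ranks layer by layer** (they are unit twists of each other and unit twists do
not move the layers, `ZpExtension.layer_unitTwist`), for any `NumberField` instances. [cite: Washington1997, §13.1 (`K_∞` does not depend on the choice of `κ`)] -/
theorem index_range_pow_narrowClassGroup_layer_eq_of_isCyclotomic [NumberField K] (κ₁ κ₂ : ZpExtension K 2)
    (h₁ : κ₁.IsCyclotomic) (h₂ : κ₂.IsCyclotomic) (m q : ℕ) [NumberField (κ₁.layer m)] [NumberField (κ₂.layer m)] :
    (powMonoidHom (α := NarrowClassGroup (κ₂.layer m)) q).range.index = (powMonoidHom (α := NarrowClassGroup (κ₁.layer m)) q).range.index := by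
  haveI : Fact (Nat.Prime 2) := ⟨Nat.prime_two⟩
  obtain ⟨u, hu⟩ := ZpExtension.IsCyclotomic.exists_eq_unitTwist_holds h₁ h₂
  have hlayer : κ₂.layer m = κ₁.layer m := by rw [hu]; exact ZpExtension.layer_unitTwist κ₁ u m
  exact index_range_pow_narrowClassGroup_eq_of_ringEquiv (IntermediateField.equivOfEq hlayer).toRingEquiv q

/-! ## §2 `(θ)^{2ⁿ} = (2)`: a root of `Ψ_n` forces `2ⁿ ∣ e(Q|2)` -/

section Ideal

/-- **Unit lemma.** In a commutative ring: if `θ^N = 2u`, `u ≡ ε (mod θ)` and `ε` is a unit, then `u` is a unit — a maximal ideal containing `u`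
would contain `θ^N`, hence `θ`, hence `ε = u − (u − ε)`. (For an Eisenstein polynomial `X^N + 2q`, `q(0) = ±1`, at a root `θ`: `u = −q(θ)`.)
[cite: NeukirchANT1999, Ch. II §6 (Eisenstein polynomials give totally ramified extensions, `(p) = (π)^N`)] -/
theorem isUnit_of_pow_eq_two_mul {A : Type*} [CommRing A] {θ u ε : A} {N : ℕ} (hε : IsUnit ε)
    (hN : θ ^ N = 2 * u) (hu : u - ε ∈ Ideal.span {θ}) : IsUnit u := by
  by_contra h
  obtain ⟨M, hM, hle⟩ := Ideal.exists_le_maximal (Ideal.span {u}) (fun htop => h (Ideal.span_singleton_eq_top.mp htop))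
  have huM : u ∈ M := hle (Ideal.mem_span_singleton_self u)
  have hθN : θ ^ N ∈ M := by rw [hN]; exact M.mul_mem_left 2 huM
  have hθ : θ ∈ M := hM.isPrime.mem_of_pow_mem N hθN
  have hdiff : u - ε ∈ M := ((Ideal.span_singleton_le_iff_mem _).mpr hθ) hu
  have hεM : ε ∈ M := by
    have : ε = u - (u - ε) := by ring
    rw [this]; exact M.sub_mem huM hdiff
  exact hM.ne_top (M.eq_top_of_isUnit_mem hεM hε)

variable {L : Type*} [Field L] [NumberField L]

omit [NumberField L] in
/-- A root of `Ψ_n` in a number field that is an algebraic integer is a root of `Ψ_n` in `𝓞 L`. [cite: Washington1997, §13.1] -/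
private theorem iterate_ringOfIntegers_eq_zero {θ' : 𝓞 L} {n : ℕ} (hθ : (fun x : L => x ^ 2 - 2)^[n] (θ' : L) = 0) :
    (fun x : 𝓞 L => x ^ 2 - 2)^[n] θ' = 0 := by
  have h := NestedSqrtTwo.map_iterate (algebraMap (𝓞 L) L) θ' n
  rw [show algebraMap (𝓞 L) L θ' = (θ' : L) from rfl, hθ] at h
  exact (map_eq_zero_iff _ (RingOfIntegers.coe_injective (K := L))).mp h

omit [NumberField L] in
/-- **`2𝓞_L = (θ)^{2^{n+1}}` for an algebraic integer `θ ∈ 𝓞_L` that is a root of `Ψ_{n+1}`.**  Write `Ψ_{n+1} = X^{2^{n+1}} + 2q` with `q(0)² = 1`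
(`NestedSqrtTwo.exists_eq_X_pow_add_C_two_mul`); at `θ`: `θ^{2^{n+1}} = 2·(−q(θ))` with `−q(θ) ≡ −q(0) = ∓1 (mod θ)` a unit (§2 unit lemma), so the
principal ideals `(θ^{2^{n+1}})` and `(2)` agree.  (`ℚ(θ) = ℚ_{n+1}` is totally ramified at `2`: `(2) = 𝔭^{2^{n+1}}`, `𝔭 = (θ)`.)  Every root of `Ψ_{n+1}` in `L`
is such a `θ` (`NestedSqrtTwo.isIntegral`). [cite: Washington1997, §13.1 and Prop. 13.2 (`2` totally ramified in `ℚ_n`)] [cite: NeukirchANT1999, Ch. II §6] -/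
theorem span_two_eq_span_singleton_pow {θ' : 𝓞 L} {n : ℕ} (hθ : (fun x : 𝓞 L => x ^ 2 - 2)^[n + 1] θ' = 0) :
    Ideal.span {(2 : 𝓞 L)} = Ideal.span {θ'} ^ 2 ^ (n + 1) := by
  obtain ⟨q, hq, hq0⟩ := NestedSqrtTwo.exists_eq_X_pow_add_C_two_mul n
  -- `θ'^{2^{n+1}} + 2 q(θ') = 0`
  have hroot : aeval θ' (((X ^ 2 - C 2 : ℤ[X]).comp)^[n + 1] X) = 0 := by
    rw [NestedSqrtTwo.aeval_eq_iterate, hθ]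
  rw [hq] at hroot
  simp only [map_add, map_pow, aeval_X, map_mul, map_ofNat] at hroot
  have hN : θ' ^ 2 ^ (n + 1) = 2 * (-aeval θ' q) := by linear_combination hroot
  -- `−q(θ') ≡ −q(0) (mod θ')`, and `q(0)² = 1`
  obtain ⟨r, hr⟩ := (X_dvd_sub_C (p := q) : X ∣ q - C (q.coeff 0))
  have hmem : -aeval θ' q - (-((q.coeff 0 : ℤ) : 𝓞 L)) ∈ Ideal.span {θ'} := by
    have hqr : aeval θ' q - ((q.coeff 0 : ℤ) : 𝓞 L) = θ' * aeval θ' r := by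
      have h := congrArg (aeval θ') hr
      rw [map_sub, aeval_C, algebraMap_int_eq, map_mul, aeval_X] at h
      exact_mod_cast h
    rw [show -aeval θ' q - (-((q.coeff 0 : ℤ) : 𝓞 L)) = -(aeval θ' q - ((q.coeff 0 : ℤ) : 𝓞 L)) by ring, hqr]
    exact Submodule.neg_mem _ (Ideal.mul_mem_right _ _ (Ideal.mem_span_singleton_self θ'))
  have hε : IsUnit (-((q.coeff 0 : ℤ) : 𝓞 L)) := by
    refine isUnit_iff_exists_inv.mpr ⟨-((q.coeff 0 : ℤ) : 𝓞 L), ?_⟩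
    have h1 : ((q.coeff 0 : ℤ) : 𝓞 L) ^ 2 = 1 := by exact_mod_cast congrArg (fun z : ℤ => (z : 𝓞 L)) hq0
    linear_combination h1
  have hunit : IsUnit (-aeval θ' q) := isUnit_of_pow_eq_two_mul hε hN hmem
  rw [Ideal.span_singleton_pow, hN, Ideal.span_singleton_mul_right_unit hunit]

/-- **`2ⁿ ∣ e(Q|2)` for every prime `Q ∣ 2` of a number field `L` containing a root of `Ψ_n`** (`2𝓞_L = (θ)^{2ⁿ}`, so the exponent of `Q` in `2𝓞_L` is `2ⁿ`
times that in `(θ)`; `n = 0` is vacuous).  The case `n = 2` is GEN 10's `four_dvd_ramificationIdx_int_of_quartic_root`.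
[cite: Washington1997, §13.1 and Prop. 13.2] [cite: NeukirchANT1999, Ch. I §8] -/
theorem pow_dvd_ramificationIdx_int_of_iterate_root {θ : L} {n : ℕ} (hθ : (fun x : L => x ^ 2 - 2)^[n] θ = 0) (Q : Ideal (𝓞 L))
    [Q.IsPrime] [Q.LiesOver (Ideal.span {(2 : ℤ)})] : 2 ^ n ∣ Q.ramificationIdx ℤ := by
  classical
  cases n with
  | zero => exact one_dvd _
  | succ n =>
    set θ' : 𝓞 L := ⟨θ, NestedSqrtTwo.isIntegral (R := ℤ) hθ⟩ with hθ'
    have hθ'0 : (fun x : 𝓞 L => x ^ 2 - 2)^[n + 1] θ' = 0 := iterate_ringOfIntegers_eq_zero (by rw [hθ']; exact hθ)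
    have hspan := span_two_eq_span_singleton_pow hθ'0
    have hmap : Ideal.map (algebraMap ℤ (𝓞 L)) (Ideal.span {(2 : ℤ)}) = Ideal.span {θ'} ^ 2 ^ (n + 1) := by
      rw [Ideal.map_span, Set.image_singleton, map_ofNat, hspan]
    have hp0 : Ideal.map (algebraMap ℤ (𝓞 L)) (Ideal.span {(2 : ℤ)}) ≠ ⊥ :=
      Ideal.map_ne_bot_of_ne_bot (by simp)
    rw [Ideal.IsDedekindDomain.ramificationIdx_eq_normalizedFactors_count (Ideal.span {(2 : ℤ)}) Q hp0,
      hmap, normalizedFactors_pow, Multiset.count_nsmul]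
    exact dvd_mul_right _ _

end Ideal

/-! ## §3 Fukuda's index `≤ m` from `2^{m+1} ∤ e(w|2)`; odd degree `< 2^{m+1}` -/

section Index

omit [NumberField K] in
/-- A place of `K` containing `2` lies over `(2) ⊂ ℤ`. [folklore] -/
private theorem liesOver_span_two_of_mem'' [NumberField K] (w : HeightOneSpectrum (𝓞 K)) (hw : ((2 : ℕ) : 𝓞 K) ∈ w.asIdeal) :
    w.asIdeal.LiesOver (Ideal.span {(2 : ℤ)}) := by
  rw [Ideal.liesOver_span_iff w.isPrime.ne_top Int.prime_two, map_ofNat]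
  exact_mod_cast hw

/-- **`2ⁿ ∤ e(w|2)` ⟹ `w` ramifies in `K_n`.**  For a number field `K` with `2 ∤ [K:ℚ]`, a cyclotomic `ℤ₂`-extension `κ` of `K` and a place `w ∣ 2` of `K`
whose ramification index over `ℤ` is not divisible by `2ⁿ`, the place `w` is ramified in `K_n = κ.layer n`: for `Q ∣ w` in `K_n ∋ θ_n`,
`e(Q|2) = e(w|2)e(Q|w)` is divisible by `2ⁿ` (§2), so `e(Q|w) ≠ 1`. [cite: Washington1997, §13.1 and Prop. 13.2] [cite: NeukirchANT1999, Ch. I §8] -/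
theorem not_isUnramifiedIn_layer_of_not_pow_dvd_ramificationIdx (hK : ¬ 2 ∣ Module.finrank ℚ K)
    (κ : ZpExtension K 2) (hκ : κ.IsCyclotomic) (n : ℕ) {w : HeightOneSpectrum (𝓞 K)}
    (hw : ((2 : ℕ) : 𝓞 K) ∈ w.asIdeal) (hn : ¬ 2 ^ n ∣ w.asIdeal.ramificationIdx ℤ) :
    ¬ Algebra.IsUnramifiedIn (𝓞 (κ.layer n)) w.asIdeal := by
  haveI : Fact (Nat.Prime 2) := ⟨Nat.prime_two⟩
  haveI : FiniteDimensional K (κ.layer n) := κ.finiteDimensional_layer_holds n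
  haveI : NumberField (κ.layer n) := NumberField.of_module_finite K _
  intro hunr
  obtain ⟨θ, hθ⟩ := exists_iterate_root_layer_of_not_dvd_finrank hK κ hκ n
  haveI : w.asIdeal.IsPrime := w.isPrime
  haveI := liesOver_span_two_of_mem'' w hw
  obtain ⟨⟨Q, hQprime, hQover⟩⟩ :=
    (inferInstance : Nonempty (Ideal.primesOver w.asIdeal (𝓞 (κ.layer n))))
  haveI := hQprime
  haveI := hQover
  haveI : Q.LiesOver (Ideal.span {(2 : ℤ)}) := Ideal.LiesOver.trans Q w.asIdeal _
  have h1 : Q.ramificationIdx (𝓞 K) = 1 := hunr.ramificationIdx_eq_one hQover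
  have hdvd := pow_dvd_ramificationIdx_int_of_iterate_root hθ Q
  rw [Ideal.ramificationIdx_tower w.asIdeal Q, h1, mul_one] at hdvd
  exact hn hdvd

/-- **Fukuda's index is `≤ m` when no prime above `2` has `2^{m+1} ∣ e`.**  For a number field `K` with `2 ∤ [K:ℚ]` and a cyclotomic `ℤ₂`-extension `κ`: if
every place `w ∣ 2` of `K` has `2^{m+1} ∤ e(w|2)`, then every `w ∣ 2` is ramified in `K_{m+1}`, hence every prime ramified in `K_∞/K` is totally ramified in
`K_∞/K_m` — `TotallyRamifiedFrom κ m` (GEN 10's `totallyRamifiedFrom_of_forall_not_isUnramifiedIn_layer_succ`).  The case `m = 1` is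
`totallyRamifiedFrom_one_of_forall_not_four_dvd_ramificationIdx`. [cite: Washington1997, §13.1 Lemma 13.3 (proof)] [cite: Fukuda1994, p. 264] -/
theorem totallyRamifiedFrom_of_forall_not_pow_succ_dvd_ramificationIdx (hK : ¬ 2 ∣ Module.finrank ℚ K)
    (κ : ZpExtension K 2) (hκ : κ.IsCyclotomic) (m : ℕ)
    (h : ∀ w : HeightOneSpectrum (𝓞 K), ((2 : ℕ) : 𝓞 K) ∈ w.asIdeal → ¬ 2 ^ (m + 1) ∣ w.asIdeal.ramificationIdx ℤ) :
    TotallyRamifiedFrom κ m :=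
  haveI : Fact (Nat.Prime 2) := ⟨Nat.prime_two⟩
  totallyRamifiedFrom_of_forall_not_isUnramifiedIn_layer_succ κ m fun w hw =>
    not_isUnramifiedIn_layer_of_not_pow_dvd_ramificationIdx hK κ hκ (m + 1) hw (h w hw)

/-- **Odd degree `< 2^{m+1}` ⟹ Fukuda index `≤ m`, for every cyclotomic `ℤ₂`-extension** (`e(w|2) ≤ [K:ℚ] < 2^{m+1}` for every `w ∣ 2`).  Degree `3` ⟹ index
`≤ 1` (GEN 10's `forall_totallyRamifiedFrom_one_of_finrank_eq_three`); degrees `5, 7` ⟹ `≤ 2`; degrees `9, …, 15` ⟹ `≤ 3`.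
[cite: Washington1997, §13.1 Lemma 13.3 (proof)] [cite: Fukuda1994, p. 264] [cite: NeukirchANT1999, Ch. I §8 Prop. (8.2)] -/
theorem forall_totallyRamifiedFrom_of_finrank_lt (hK : ¬ 2 ∣ Module.finrank ℚ K) (m : ℕ)
    (hlt : Module.finrank ℚ K < 2 ^ (m + 1)) : ∀ κ : ZpExtension K 2, κ.IsCyclotomic → TotallyRamifiedFrom κ m := by
  intro κ hκ
  refine totallyRamifiedFrom_of_forall_not_pow_succ_dvd_ramificationIdx hK κ hκ m fun w hw hdvd => ?_
  have hle := ramificationIdx_int_le_finrank (K := K) hw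
  haveI : Fact (Nat.Prime 2) := ⟨Nat.prime_two⟩
  haveI : w.asIdeal.IsPrime := w.isPrime
  have hpos : 0 < w.asIdeal.ramificationIdx ℤ := Ideal.ramificationIdx_pos w.asIdeal ℤ
  exact absurd ((Nat.le_of_dvd hpos hdvd).trans hle) (not_le.mpr hlt)

end Index

/-! ## §4 The rung-`m` narrow rank certificate: abstract layers, and concrete models -/

/-- **NARROW FUKUDA, RUNG `m`, ABSTRACT LAYERS — with ONE narrow-defect bound uniform in the cyclotomic `κ`.**  Let `F` be a number field and `m : ℕ` such that every
cyclotomic `ℤ₂`-extension `κ` of `F` has Fukuda index `≤ m` and equal narrow `2`-ranks `[Cl⁺(F_{m+1}) : Cl⁺(F_{m+1})²] = [Cl⁺(F_m) : Cl⁺(F_m)²]` (any `NumberField`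
instances on the layers).  Then (a) Iwasawa's `μ₂ = 0` for every cyclotomic `κ`, and (b) there is ONE `D` with `ord₂ h⁺(F_j) ≤ ord₂ h(F_j) + D` for every cyclotomic `κ`
and every layer `F_j` (all cyclotomic `κ` share their layers, §1; `D = max_{j ≤ m} rank₂ Cl⁺(F_j)` via GEN 9's `NarrowFukuda.narrowMu_of_narrowRankCertificate`).
[cite: Fukuda1994, Thm. 1 (2), p. 264] [cite: Kida1982JFields, main theorem (μ-part; shape only)] -/
theorem NarrowFukuda.narrowMu_of_index_le_of_succ_eq (F : Type) [Field F] [NumberField F] (m : ℕ)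
    (hidx : ∀ κ : ZpExtension F 2, κ.IsCyclotomic → TotallyRamifiedFrom κ m)
    (hcert : ∀ κ : ZpExtension F 2, κ.IsCyclotomic → ∀ [NumberField (κ.layer m)] [NumberField (κ.layer (m + 1))],
      (powMonoidHom (α := NarrowClassGroup (κ.layer (m + 1))) 2).range.index =
        (powMonoidHom (α := NarrowClassGroup (κ.layer m)) 2).range.index) :
    (∀ κ : ZpExtension F 2, κ.IsCyclotomic → ClassicalMuVanishes κ) ∧
    ∃ D : ℕ, ∀ κ : ZpExtension F 2, κ.IsCyclotomic → ∀ j : ℕ, ∀ [NumberField (κ.layer j)],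
      padicValNat 2 (narrowClassNumber (κ.layer j)) ≤ padicValNat 2 (classNumber (κ.layer j)) + D := by
  classical
  haveI : Fact (Nat.Prime 2) := ⟨Nat.prime_two⟩
  by_cases hex : ∃ κ₀ : ZpExtension F 2, κ₀.IsCyclotomic
  · obtain ⟨κ₀, hκ₀⟩ := hex
    have hinst : ∀ j : ℕ, NumberField (κ₀.layer j) := fun j =>
      haveI : FiniteDimensional F (κ₀.layer j) := κ₀.finiteDimensional_layer_holds j
      NumberField.of_module_finite F _
    let f : ℕ → ℕ := fun j => by
      haveI := hinst j
      exact padicValNat 2 (powMonoidHom (α := NarrowClassGroup (κ₀.layer j)) 2).range.index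
    set B : ℕ := (Finset.range (m + 1)).sup f with hB
    obtain ⟨hμ, hδ⟩ := NarrowFukuda.narrowMu_of_narrowRankCertificate F m B fun κ hκ => ⟨hidx κ hκ, hcert κ hκ, fun j hj _ => by
      rw [index_range_pow_narrowClassGroup_layer_eq_of_isCyclotomic κ₀ κ hκ₀ hκ j 2]
      have hfj : padicValNat 2 (powMonoidHom (α := NarrowClassGroup (κ₀.layer j)) 2).range.index = f j := rfl
      rw [hfj]
      exact Finset.le_sup (f := f) (Finset.mem_range.mpr (Nat.lt_succ_of_le hj))⟩
    exact ⟨hμ, B, hδ⟩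
  · exact ⟨fun κ hκ => (hex ⟨κ, hκ⟩).elim, 0, fun κ hκ => (hex ⟨κ, hκ⟩).elim⟩

/-- ★ **NARROW FUKUDA, RUNG `m`, CONCRETE MODELS.**  Let `K` be a number field of ODD degree such that every cyclotomic `ℤ₂`-extension of `K` has Fukuda index `≤ m`
(§3: automatic when `[K:ℚ] < 2^{m+1}`); let `L ⊇ K` be ANY extension of degree `2^m` containing a root `θ` of `Ψ_m` (a model of `K_m`) and `L' ⊇ K` ANY extension of
degree `2^{m+1}` containing a root `θ'` of `Ψ_{m+1}` (a model of `K_{m+1}`), with **`[Cl⁺(L') : Cl⁺(L')²] = [Cl⁺(L) : Cl⁺(L)²]`** (`rank₂ Cl⁺(K_{m+1}) = rank₂ Cl⁺(K_m)`).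
Then (a) Iwasawa's `μ₂ = 0` for every cyclotomic `ℤ₂`-extension of `K` and (b) ONE `D` bounds the narrow defect `ord₂ h⁺(K_j) − ord₂ h(K_j)` of every layer of every
cyclotomic `ℤ₂`-extension — hypotheses `hμ`, `D`, `hδ` of the Kida-lite ascent.  Rungs `m = 0, 1` are GEN 9/10's `narrowMu_of_layerOne_model` /
`narrowMu_of_layerTwo_model` (with an explicit `D`). [cite: Fukuda1994, Thm. 1 (2), p. 264] [cite: Washington1997, §13.1] [cite: Kida1982JFields, main theorem (μ-part; shape only)] -/
theorem NarrowFukuda.narrowMu_of_layer_models (K : Type) [Field K] [NumberField K] (hodd : Odd (Module.finrank ℚ K)) (m : ℕ)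
    (hidx : ∀ κ : ZpExtension K 2, κ.IsCyclotomic → TotallyRamifiedFrom κ m)
    (L : Type) [Field L] [NumberField L] [Algebra K L] (hL : Module.finrank K L = 2 ^ m) (θ : L)
    (hθ : (fun x : L => x ^ 2 - 2)^[m] θ = 0)
    (L' : Type) [Field L'] [NumberField L'] [Algebra K L'] (hL' : Module.finrank K L' = 2 ^ (m + 1)) (θ' : L')
    (hθ' : (fun x : L' => x ^ 2 - 2)^[m + 1] θ' = 0)
    (hr : (powMonoidHom (α := NarrowClassGroup L') 2).range.index = (powMonoidHom (α := NarrowClassGroup L) 2).range.index) :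
    (∀ κ : ZpExtension K 2, κ.IsCyclotomic → ClassicalMuVanishes κ) ∧
    ∃ D : ℕ, ∀ κ : ZpExtension K 2, κ.IsCyclotomic → ∀ j : ℕ, ∀ [NumberField (κ.layer j)],
      padicValNat 2 (narrowClassNumber (κ.layer j)) ≤ padicValNat 2 (classNumber (κ.layer j)) + D :=
  NarrowFukuda.narrowMu_of_index_le_of_succ_eq K m hidx fun κ hκ _ _ =>
    (index_range_pow_narrowClassGroup_layer_eq_of_iterate_root hodd κ hκ L' hL' θ' hθ' 2).trans
      (hr.trans (index_range_pow_narrowClassGroup_layer_eq_of_iterate_root hodd κ hκ L hL θ hθ 2).symm)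

/-- **The same with the index hypothesis discharged by the degree: `[K:ℚ]` odd and `< 2^{m+1}`** (§3). [cite: Fukuda1994, Thm. 1 (2), p. 264] [cite: Washington1997, §13.1 and Lemma 13.3] -/
theorem NarrowFukuda.narrowMu_of_layer_models_of_finrank_lt (K : Type) [Field K] [NumberField K] (hodd : Odd (Module.finrank ℚ K)) (m : ℕ)
    (hlt : Module.finrank ℚ K < 2 ^ (m + 1))
    (L : Type) [Field L] [NumberField L] [Algebra K L] (hL : Module.finrank K L = 2 ^ m) (θ : L)
    (hθ : (fun x : L => x ^ 2 - 2)^[m] θ = 0)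
    (L' : Type) [Field L'] [NumberField L'] [Algebra K L'] (hL' : Module.finrank K L' = 2 ^ (m + 1)) (θ' : L')
    (hθ' : (fun x : L' => x ^ 2 - 2)^[m + 1] θ' = 0)
    (hr : (powMonoidHom (α := NarrowClassGroup L') 2).range.index = (powMonoidHom (α := NarrowClassGroup L) 2).range.index) :
    (∀ κ : ZpExtension K 2, κ.IsCyclotomic → ClassicalMuVanishes κ) ∧
    ∃ D : ℕ, ∀ κ : ZpExtension K 2, κ.IsCyclotomic → ∀ j : ℕ, ∀ [NumberField (κ.layer j)],
      padicValNat 2 (narrowClassNumber (κ.layer j)) ≤ padicValNat 2 (classNumber (κ.layer j)) + D :=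
  NarrowFukuda.narrowMu_of_layer_models K hodd m
    (forall_totallyRamifiedFrom_of_finrank_lt (fun h => (Nat.not_even_iff_odd.mpr hodd) (even_iff_two_dvd.mpr h)) m hlt)
    L hL θ hθ L' hL' θ' hθ' hr

/-- ★ **CUBIC FIELDS, ANY RUNG `m ≥ 1`, NO OTHER HYPOTHESIS.**  `K` a cubic number field (Fukuda index `≤ 1 ≤ m` for every cyclotomic `ℤ₂`-extension); `L/K` of degree
`2^m` with a root of `Ψ_m`, `L'/K` of degree `2^{m+1}` with a root of `Ψ_{m+1}`; `[Cl⁺(L') : Cl⁺(L')²] = [Cl⁺(L) : Cl⁺(L)²]` ⟹ (a) `μ₂ = 0` for every cyclotomic `ℤ₂`-extension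
of `K` ∧ (b) a uniform narrow-defect bound.  The rung to use when the narrow `2`-rank still grows between the layers `m − 1` and `m` (degrees `3·2^m` and `3·2^{m+1}`).
[cite: Fukuda1994, Thm. 1 (2), p. 264] [cite: Washington1997, §13.1 and Lemma 13.3] -/
theorem NarrowFukuda.narrowMu_of_layer_models_of_finrank_eq_three (K : Type) [Field K] [NumberField K]
    (h3 : Module.finrank ℚ K = 3) (m : ℕ) (hm : 1 ≤ m)
    (L : Type) [Field L] [NumberField L] [Algebra K L] (hL : Module.finrank K L = 2 ^ m) (θ : L)
    (hθ : (fun x : L => x ^ 2 - 2)^[m] θ = 0)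
    (L' : Type) [Field L'] [NumberField L'] [Algebra K L'] (hL' : Module.finrank K L' = 2 ^ (m + 1)) (θ' : L')
    (hθ' : (fun x : L' => x ^ 2 - 2)^[m + 1] θ' = 0)
    (hr : (powMonoidHom (α := NarrowClassGroup L') 2).range.index = (powMonoidHom (α := NarrowClassGroup L) 2).range.index) :
    (∀ κ : ZpExtension K 2, κ.IsCyclotomic → ClassicalMuVanishes κ) ∧
    ∃ D : ℕ, ∀ κ : ZpExtension K 2, κ.IsCyclotomic → ∀ j : ℕ, ∀ [NumberField (κ.layer j)],
      padicValNat 2 (narrowClassNumber (κ.layer j)) ≤ padicValNat 2 (classNumber (κ.layer j)) + D :=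
  haveI : Fact (Nat.Prime 2) := ⟨Nat.prime_two⟩
  NarrowFukuda.narrowMu_of_layer_models K (by rw [h3]; decide) m
    (fun κ hκ => (forall_totallyRamifiedFrom_one_of_finrank_eq_three h3 κ hκ).mono hm) L hL θ hθ L' hL' θ' hθ' hr

/-- `(x ↦ x² − 2)^{∘2}(x) = (x² − 2)² − 2`. [cite: Washington1997, §13.1] -/
theorem iterate_sq_sub_two_two {A : Type*} [CommRing A] (x : A) : (fun x : A => x ^ 2 - 2)^[2] x = (x ^ 2 - 2) ^ 2 - 2 := by
  simp only [Function.iterate_succ_apply, Function.iterate_zero_apply]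

/-- `(x ↦ x² − 2)^{∘3}(x) = ((x² − 2)² − 2)² − 2`. [cite: Washington1997, §13.1] -/
theorem iterate_sq_sub_two_three {A : Type*} [CommRing A] (x : A) :
    (fun x : A => x ^ 2 - 2)^[3] x = ((x ^ 2 - 2) ^ 2 - 2) ^ 2 - 2 := by
  simp only [Function.iterate_succ_apply, Function.iterate_zero_apply]

/-- ★ **THE RUNG `m = 2` OF A CUBIC FIELD, SPELLED OUT: `rank₂ Cl⁺(K(θ₃)) = rank₂ Cl⁺(K(θ₂))`, `θ₂⁴ − 4θ₂² + 2 = 0`, `θ₃⁸ − 8θ₃⁶ + 20θ₃⁴ − 16θ₃² + 2 = 0`.**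
`K` cubic; `L₂/K` of degree `4` with a root `θ₂` of `X⁴ − 4X² + 2` (a model of `K_2 = K(√(2+√2))`, degree `12` over `ℚ`); `L₃/K` of degree `8` with a root `θ₃` of
`X⁸ − 8X⁶ + 20X⁴ − 16X² + 2` (a model of `K_3 = K(ζ₃₂ + ζ₃₂⁻¹)`, degree `24`); `[Cl⁺(L₃) : Cl⁺(L₃)²] = [Cl⁺(L₂) : Cl⁺(L₂)²]` ⟹ (a) ∧ (b).  The rung for rows whose narrow
`2`-rank grows between the layers `0, 1` AND `1, 2`. [cite: Fukuda1994, Thm. 1 (2), p. 264] [cite: Washington1997, §13.1 and Lemma 13.3] -/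
theorem NarrowFukuda.narrowMu_of_layerThree_model_of_finrank_eq_three (K : Type) [Field K] [NumberField K]
    (h3 : Module.finrank ℚ K = 3)
    (L₂ : Type) [Field L₂] [NumberField L₂] [Algebra K L₂] (hL₂ : Module.finrank K L₂ = 4) (θ₂ : L₂) (hθ₂ : θ₂ ^ 4 - 4 * θ₂ ^ 2 + 2 = 0)
    (L₃ : Type) [Field L₃] [NumberField L₃] [Algebra K L₃] (hL₃ : Module.finrank K L₃ = 8) (θ₃ : L₃)
    (hθ₃ : θ₃ ^ 8 - 8 * θ₃ ^ 6 + 20 * θ₃ ^ 4 - 16 * θ₃ ^ 2 + 2 = 0)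
    (hr : (powMonoidHom (α := NarrowClassGroup L₃) 2).range.index = (powMonoidHom (α := NarrowClassGroup L₂) 2).range.index) :
    (∀ κ : ZpExtension K 2, κ.IsCyclotomic → ClassicalMuVanishes κ) ∧
    ∃ D : ℕ, ∀ κ : ZpExtension K 2, κ.IsCyclotomic → ∀ j : ℕ, ∀ [NumberField (κ.layer j)],
      padicValNat 2 (narrowClassNumber (κ.layer j)) ≤ padicValNat 2 (classNumber (κ.layer j)) + D :=
  NarrowFukuda.narrowMu_of_layer_models_of_finrank_eq_three K h3 2 (by norm_num) L₂ (by rw [hL₂]; norm_num) θ₂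
    (by rw [iterate_sq_sub_two_two]; linear_combination hθ₂) L₃ (by rw [hL₃]; norm_num) θ₃
    (by rw [iterate_sq_sub_two_three]; linear_combination hθ₃) hr

end Literature.NumberTheory.IwasawaTheory

end
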